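import Mathlib
import Summits.Ventures.PercRepro2.LocRows
import Summits.Ventures.PercRepro2.SwRow
import Summits.Ventures.PercRepro2.SwOut
import Summits.Ventures.PercRepro2.SwAllRow
import Summits.Ventures.PercRepro2.SwOutAll
import Summits.Ventures.PercRepro2.SwOutArmFlip
import Summits.Ventures.PercRepro2.SwOutArmThm

/-!
# The core cube: vocabulary (blind cell PercRepro2, night-4 g13, 2026-08-26;
proofs/NIGHT4-G12.md §2 (2.1), proofs/NIGHT4-G13.md §2)

Around a junction `u` that can be a CORE of `h` (a vertex of both clusters of `h`), the class is
no longer a union of arm orbits: a core point has ARMS — the components of `G[H ∖ {h, u}]` — of two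
kinds, the h-ARMS (every vertex joined to `h` by a red path inside the arm) and the PURE arms (no
edge to `h`, every vertex joined to `u` by a red path inside the arm).  `CoreBase` records such a
base configuration `ζ` with all arms red; `coreReal ζ ω` flips the arms a cube point `ω` assigns
`false`.  The red cluster of `h` of a cube point is `redSet ω` — `h`, the red h-arms, and, when a red
h-arm is adjacent to `u` (`uRed ω`), `u` together with the red pure arms (proved in
`SwOutCoreHull`).  This file: the definitions and the bookkeeping of which edges a flip touches.
-/

namespace Summit.Ventures.PercRepro2

namespace LocRows

open Hull

variable {V : Type*} {E : Type*}

open scoped Classical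

variable (ends : E → Sym2 V)

/-- The red edges of `ζ` inside the vertex set `S`. -/
noncomputable def insideConfig (S : Set V) (ζ : Config E) : Config E :=
  fun e => ζ e && decide (e ∈ within ends S)

variable {ends}

/-- The inside colouring is below the colouring. -/
lemma insideConfig_le (S : Set V) (ζ : Config E) : insideConfig ends S ζ ≤ ζ := by
  intro e
  simp only [insideConfig]
  cases ζ e <;> simp

/-- Membership in the inside colouring. -/
lemma insideConfig_eq_true_iff {S : Set V} {ζ : Config E} {e : E} :
    insideConfig ends S ζ e = true ↔ ζ e = true ∧ e ∈ within ends S := by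
  simp [insideConfig]

/-- **The data of a core cube**: a base configuration `ζ` (every arm red), the junction `u`, the
hull `H` of the base, and a family of arms `A i` (pairwise disjoint, covering `H ∖ {h, u}`, no edge
between two arms, no edge from `H` to the outside that is red); `h` and `u` see only arms, by red
edges; some h-arm is adjacent to `u`; each h-arm is red-connected to `h` inside itself, each pure
arm red-connected to `u` inside itself, and pure arms have no edge to `h`. -/
structure CoreBase (ends : E → Sym2 V) (ζ : Config E) (h u : V) (H : Set V) {ι : Type*}
    (A : ι → Set V) (pure : ι → Prop) : Prop where
  hne : h ≠ u
  bdry_blue : ∀ e x y, ends e = s(x, y) → x ∈ H → y ∉ H → ζ e = false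
  arm_sub : ∀ i, ∀ x ∈ A i, x ∈ H ∧ x ≠ h ∧ x ≠ u
  arm_nonempty : ∀ i, (A i).Nonempty
  arm_disj : ∀ i j, i ≠ j → ∀ x, x ∈ A i → x ∉ A j
  arm_cover : ∀ x ∈ H, x ≠ h → x ≠ u → ∃ i, x ∈ A i
  no_cross : ∀ i j, i ≠ j → ∀ e x y, ends e = s(x, y) → x ∈ A i → y ∈ A j → False
  h_edges : ∀ e x, ends e = s(h, x) → ∃ i, x ∈ A i
  h_red : ∀ e x, ends e = s(h, x) → ζ e = true
  u_edges : ∀ e x, ends e = s(u, x) → ∃ i, x ∈ A i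
  u_red : ∀ e x, ends e = s(u, x) → ζ e = true
  u_hadj : ∃ i, ¬ pure i ∧ ∃ e x, ends e = s(u, x) ∧ x ∈ A i
  harm_conn : ∀ i, ¬ pure i → ∀ x ∈ A i, x ∈ cluster ends (insideConfig ends (A i ∪ {h}) ζ) h
  pure_conn : ∀ i, pure i → ∀ x ∈ A i, x ∈ cluster ends (insideConfig ends (A i ∪ {u}) ζ) u
  pure_no_h : ∀ i, pure i → ∀ e x, ends e = s(h, x) → x ∉ A i

section Defs

variable {ι : Type*} (A : ι → Set V)

/-- The union of the arms assigned `false` by a cube point. -/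
def armsFalseC (ω : Config ι) : Set V := {x | ∃ i, ω i = false ∧ x ∈ A i}

/-- The union of the arms assigned `true` by a cube point. -/
def armsTrueC (ω : Config ι) : Set V := {x | ∃ i, ω i = true ∧ x ∈ A i}

/-- The union of all arms. -/
def allArms : Set V := {x | ∃ i, x ∈ A i}

variable (ends) in
/-- The realisation of a cube point: the arms assigned `false` are flipped in the base. -/
noncomputable def coreReal (ζ : Config E) (ω : Config ι) : Config E :=
  flip ends (armsFalseC A ω) ζ

variable (ends) in
/-- `u` is red iff some red h-arm is adjacent to `u`. -/
def uRed (u : V) (pure : ι → Prop) (ω : Config ι) : Prop :=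
  ∃ i, ω i = true ∧ ¬ pure i ∧ ∃ e x, ends e = s(u, x) ∧ x ∈ A i

variable (ends) in
/-- The red cluster of `h` of a cube point: `h`, the red h-arms, and — when some red h-arm is
adjacent to `u` — `u` with the red pure arms. -/
def redSet (h u : V) (pure : ι → Prop) (ω : Config ι) : Set V :=
  {h} ∪ {x | ∃ i, ω i = true ∧ ¬ pure i ∧ x ∈ A i} ∪
    {x | uRed ends A u pure ω ∧ (x = u ∨ ∃ i, ω i = true ∧ pure i ∧ x ∈ A i)}

/-- `h`, `u` and the red arms: the red-closed envelope of the red cluster of `h`. -/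
def redAll (h u : V) (ω : Config ι) : Set V := {h} ∪ {u} ∪ armsTrueC A ω

variable {A}

/-- The arms assigned `false` by the flipped point are the arms assigned `true`. -/
lemma armsFalseC_flipAll (ω : Config ι) : armsFalseC A (flipAll ω) = armsTrueC A ω := by
  ext x
  simp only [armsFalseC, armsTrueC, Set.mem_setOf_eq, flipAll, Bool.not_eq_false']

/-- The arms assigned `true` by the flipped point are the arms assigned `false`. -/
lemma armsTrueC_flipAll (ω : Config ι) : armsTrueC A (flipAll ω) = armsFalseC A ω := by
  ext x
  simp only [armsFalseC, armsTrueC, Set.mem_setOf_eq, flipAll, Bool.not_eq_true']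

/-- The arms assigned `false` shrink as the cube point grows. -/
lemma armsFalseC_anti {ω ω' : Config ι} (hω : ω ≤ ω') : armsFalseC A ω' ⊆ armsFalseC A ω := by
  rintro x ⟨i, hi, hx⟩
  refine ⟨i, ?_, hx⟩
  have := hω i
  rw [hi] at this
  cases h' : ω i
  · rfl
  · rw [h'] at this; exact absurd this (by simp)

/-- The arms assigned `true` grow with the cube point. -/
lemma armsTrueC_mono {ω ω' : Config ι} (hω : ω ≤ ω') : armsTrueC A ω ⊆ armsTrueC A ω' := by
  rintro x ⟨i, hi, hx⟩
  refine ⟨i, ?_, hx⟩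
  have := hω i
  rw [hi] at this
  cases h' : ω' i
  · rw [h'] at this; exact absurd this (by simp)
  · rfl

/-- The arms assigned `false` are arms. -/
lemma armsFalseC_subset_allArms (ω : Config ι) : armsFalseC A ω ⊆ allArms A :=
  fun _ ⟨i, _, hx⟩ => ⟨i, hx⟩

/-- The arms assigned `true` are arms. -/
lemma armsTrueC_subset_allArms (ω : Config ι) : armsTrueC A ω ⊆ allArms A :=
  fun _ ⟨i, _, hx⟩ => ⟨i, hx⟩

end Defs

section Base

variable {ι : Type*} {A : ι → Set V} {pure : ι → Prop} {ζ : Config E} {h u : V} {H : Set V}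
  (hb : CoreBase ends ζ h u H A pure)
include hb

/-- No loop at `h`. -/
lemma CoreBase.loop_h (e : E) : ends e ≠ s(h, h) := by
  intro he
  obtain ⟨i, hi⟩ := hb.h_edges e h he
  exact (hb.arm_sub i h hi).2.1 rfl

/-- No loop at `u`. -/
lemma CoreBase.loop_u (e : E) : ends e ≠ s(u, u) := by
  intro he
  obtain ⟨i, hi⟩ := hb.u_edges e u he
  exact (hb.arm_sub i u hi).2.2 rfl

/-- No edge joins `h` and `u`. -/
lemma CoreBase.no_hu (e : E) : ends e ≠ s(h, u) := by
  intro he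
  obtain ⟨i, hi⟩ := hb.h_edges e u he
  exact (hb.arm_sub i u hi).2.2 rfl

/-- `h` lies in no arm. -/
lemma CoreBase.h_notMem_arm (i : ι) : h ∉ A i := fun hh => (hb.arm_sub i h hh).2.1 rfl

/-- `u` lies in no arm. -/
lemma CoreBase.u_notMem_arm (i : ι) : u ∉ A i := fun hu => (hb.arm_sub i u hu).2.2 rfl

/-- The two ends of an edge in arms lie in the same arm. -/
lemma CoreBase.arm_eq_of_edge {i j : ι} {e : E} {x y : V} (hxy : ends e = s(x, y)) (hx : x ∈ A i)
    (hy : y ∈ A j) : i = j := by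
  by_contra hij
  exact hb.no_cross i j hij e x y hxy hx hy

/-- An edge with an end in `A i` touches the arms assigned `false` iff `ω i = false`. -/
lemma CoreBase.touches_armsFalseC_iff {ω : Config ι} {i : ι} {e : E} {x y : V}
    (hxy : ends e = s(x, y)) (hx : x ∈ A i) :
    e ∈ touches ends (armsFalseC A ω) ↔ ω i = false := by
  constructor
  · rintro ⟨z, ⟨j, hj, hz⟩, w, hzw⟩
    rw [hxy, Sym2.eq_iff] at hzw
    rcases hzw with ⟨h1, _⟩ | ⟨_, h2⟩
    · rw [← h1] at hz
      have hji : j = i := by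
        by_contra hne
        exact hb.arm_disj j i hne x hz hx
      rw [← hji]; exact hj
    · rw [← h2] at hz
      have hij : i = j := hb.arm_eq_of_edge hxy hx hz
      rw [hij]; exact hj
  · intro hi
    exact ⟨x, ⟨i, hi, hx⟩, y, hxy⟩

/-- An edge with an end in `A i` touches the arms assigned `true` iff `ω i = true`. -/
lemma CoreBase.touches_armsTrueC_iff {ω : Config ι} {i : ι} {e : E} {x y : V}
    (hxy : ends e = s(x, y)) (hx : x ∈ A i) :
    e ∈ touches ends (armsTrueC A ω) ↔ ω i = true := by
  have := hb.touches_armsFalseC_iff (ω := flipAll ω) hxy hx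
  rw [armsFalseC_flipAll] at this
  rw [this]
  simp [flipAll]

omit hb in
/-- An edge with an end in `A i` touches all arms. -/
lemma CoreBase.touches_allArms_of_mem {i : ι} {e : E} {x y : V} (hxy : ends e = s(x, y))
    (hx : x ∈ A i) : e ∈ touches ends (allArms A) := ⟨x, ⟨i, hx⟩, y, hxy⟩

omit hb in
/-- An edge touching the arms has an end in some arm. -/
lemma CoreBase.exists_arm_of_touches_allArms {e : E} (he : e ∈ touches ends (allArms A)) :
    ∃ i x y, ends e = s(x, y) ∧ x ∈ A i := by
  obtain ⟨x, ⟨i, hx⟩, y, hxy⟩ := he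
  exact ⟨i, x, y, hxy, hx⟩

/-- The value of a realisation on an edge with an end in `A i`. -/
lemma CoreBase.coreReal_apply_of_mem {ω : Config ι} {i : ι} {e : E} {x y : V}
    (hxy : ends e = s(x, y)) (hx : x ∈ A i) :
    coreReal ends A ζ ω e = (if ω i = true then ζ e else !ζ e) := by
  unfold coreReal
  by_cases hi : ω i = true
  · rw [flip_apply_of_notMem, if_pos hi]
    rw [hb.touches_armsFalseC_iff hxy hx, hi]; decide
  · rw [flip_apply_of_mem, if_neg hi]
    rw [hb.touches_armsFalseC_iff hxy hx]
    simpa using hi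

omit hb in
/-- The value of a realisation on an edge with no end in an arm. -/
lemma CoreBase.coreReal_apply_of_notMem {ω : Config ι} {e : E}
    (he : e ∉ touches ends (allArms A)) : coreReal ends A ζ ω e = ζ e := by
  unfold coreReal
  rw [flip_apply_of_notMem]
  exact fun h' => he (touches_mono (armsFalseC_subset_allArms ω) h')

/-- An edge inside `A i ∪ {h}` or `A i ∪ {u}` is untouched by the flip of a red arm's cube
point: its colour is the base colour. -/
lemma CoreBase.coreReal_apply_of_within {ω : Config ι} {i : ι} (hi : ω i = true) {v : V}
    (hv : v = h ∨ v = u) {e : E} (he : e ∈ within ends (A i ∪ {v})) :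
    coreReal ends A ζ ω e = ζ e := by
  obtain ⟨x, hx, y, hy, hxy⟩ := he
  rcases hx with hx | hx
  · rw [hb.coreReal_apply_of_mem hxy hx, if_pos hi]
  · rcases hy with hy | hy
    · rw [hb.coreReal_apply_of_mem (ends_swap hxy) hy, if_pos hi]
    · -- a loop at `h` or at `u`
      exfalso
      rw [Set.mem_singleton_iff] at hx hy
      subst hx; subst hy
      rcases hv with rfl | rfl
      · exact hb.loop_h e hxy
      · exact hb.loop_u e hxy

/-- The red edges inside `A i ∪ {v}` of the base are red in every realisation with `A i` red. -/
lemma CoreBase.insideConfig_le_coreReal {ω : Config ι} {i : ι} (hi : ω i = true) {v : V}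
    (hv : v = h ∨ v = u) : insideConfig ends (A i ∪ {v}) ζ ≤ coreReal ends A ζ ω := by
  intro e
  by_cases he : insideConfig ends (A i ∪ {v}) ζ e = true
  · rw [he]
    obtain ⟨hζe, hw⟩ := insideConfig_eq_true_iff.1 he
    rw [hb.coreReal_apply_of_within hi hv hw, hζe]
  · simp only [Bool.not_eq_true] at he
    rw [he]
    exact Bool.false_le _

/-- **The realisation is injective.** -/
theorem CoreBase.coreReal_injective : Function.Injective (coreReal ends A ζ) := by
  intro ω ω' heq
  funext i
  obtain ⟨x, hx⟩ := hb.arm_nonempty i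
  -- `x` carries an edge
  have hxe : ∃ e, x ∈ ends e := by
    by_cases hp : pure i
    · have := hb.pure_conn i hp x hx
      exact exists_edge_of_mem_cluster (h := u) this (hb.arm_sub i x hx).2.2
    · have := hb.harm_conn i hp x hx
      exact exists_edge_of_mem_cluster (h := h) this (hb.arm_sub i x hx).2.1
  obtain ⟨e, hxe⟩ := hxe
  have hxy : ends e = s(x, Sym2.Mem.other hxe) := (Sym2.other_spec hxe).symm
  have h1 := hb.coreReal_apply_of_mem (ω := ω) hxy hx
  have h2 := hb.coreReal_apply_of_mem (ω := ω') hxy hx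
  rw [heq] at h1
  rw [h1] at h2
  by_contra hne
  have key : ∀ b b' : Bool, b ≠ b' →
      (if b = true then ζ e else !ζ e) ≠ (if b' = true then ζ e else !ζ e) := by
    intro b b' hbb'
    cases b <;> cases b' <;> simp at hbb' ⊢
  exact key _ _ hne h2

end Base

end LocRows

end Summit.Ventures.PercRepro2
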